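import Summits.Ventures.PackingBounds.Configurations.KissingBrackets
import Literature.Geometry.DiscreteGeometry.KissingNumberThreeProofs
import Literature.Geometry.DiscreteGeometry.KissingNumberFourProofs
import Summits.Ventures.PackingBounds.Configurations.Leech

/-!
# Kissing numbers `κ(3) = 12` and `κ(4) = 24` as single exact-value theorems

Framing: lottery ticket; floor = certified bounds/negative ranges. Venture `PackingBounds` (cell
`pub-packcert`).

`Configurations/KissingBrackets.lean` holds the cell's own two-sided brackets `12 ≤ κ(3) ≤ 13` and
`24 ≤ κ(4) ≤ 25` (upper ends = the cell's Delsarte LP certificates, which are not sharp in these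
dimensions). The tree ALSO holds the sharp upper bounds as sorry-free Literature theorems of an
earlier programme: `musin2006_kissing_three_holds` (`κ(3) ≤ 12`, Schütte–van der Waerden 1953 /
Musin 2006, formalised in `KissingNumberThreeProofs`) and `musin2008_kissing_four_holds`
(`κ(4) ≤ 24`, Musin 2008, formalised in `KissingNumberFourProofs` by a kernel-checked
Bachoc–Vallentin three-point certificate). Combining them with the cell's explicit configurations
(icosahedron `Icosahedron.exists_code_12`, `24`-cell `D4.exists_kissing_24`) gives the exact values as
`IsGreatest` statements about `Config.kissingSizes`, in the shape of `Config.kissing_dim8_eq`.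

No new arithmetic: pure logic over existing kernel-checked theorems.

## References
* K. Schütte, B. L. van der Waerden, Math. Ann. 125 (1953) 325–334. [`SchutteVanderwaerden1952`]
* O. R. Musin, Discrete Comput. Geom. 35 (2006) 375–384. [`Musin2005`]
* O. R. Musin, Ann. of Math. 168 (2008) 1–32. [`Musin2008`]
* J. H. Conway, N. J. A. Sloane, *Sphere Packings, Lattices and Groups*, Ch. 1 Table 1.2. [`ConwaySloane1999`]
-/

namespace Summit.Ventures.PackingBounds.Config

open Finset

/-- **`κ(3) = 12` in Lean**: `12` is the greatest element of `kissingSizes 3` (attained by the icosahedron,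
`Icosahedron.exists_code_12`, pairwise inner products `≤ 1/√5 < 1/2`; upper bound: Musin 2006 /
Schütte–van der Waerden, `Literature.Geometry.DiscreteGeometry.musin2006_kissing_three_holds`, via
`one_le_dist_iff_inner_le_half`). [cite: Musin2005, p. 4 Theorem (k(3) = 12)] -/
theorem kissing_dim3_eq : IsGreatest (kissingSizes 3) 12 := by
  refine ⟨kissing_dim3_bracket.1, ?_⟩
  rintro N ⟨C, rfl, h1, h2⟩
  refine Literature.Geometry.DiscreteGeometry.musin2006_kissing_three_holds C h1 ?_
  intro x hx y hy hxy
  exact (Literature.Geometry.DiscreteGeometry.one_le_dist_iff_inner_le_half (h1 x hx) (h1 y hy)).2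
    (h2 x hx y hy hxy)

/-- **`κ(4) = 24` in Lean**: `24` is the greatest element of `kissingSizes 4` (attained by the `24`-cell /
`D₄` roots, `D4.exists_kissing_24`; upper bound: Musin 2008,
`Literature.Geometry.DiscreteGeometry.musin2008_kissing_four_holds`, kernel-checked three-point
certificate). [cite: Musin2008, §2 Main Theorem (k(4) = 24)] -/
theorem kissing_dim4_eq : IsGreatest (kissingSizes 4) 24 := by
  refine ⟨kissing_dim4_bracket.1, ?_⟩
  rintro N ⟨C, rfl, h1, h2⟩
  exact Literature.Geometry.DiscreteGeometry.musin2008_kissing_four_holds C h1 h2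

/-- The exact kissing numbers held in the tree as `IsGreatest` theorems: `κ(3) = 12`, `κ(4) = 24`,
`κ(8) = 240`. [cite: ConwaySloane1999, Ch. 1 Table 1.2] -/
theorem kissing_exact_dims_3_4_8 :
    IsGreatest (kissingSizes 3) 12 ∧ IsGreatest (kissingSizes 4) 24 ∧ IsGreatest (kissingSizes 8) 240 :=
  ⟨kissing_dim3_eq, kissing_dim4_eq, kissing_dim8_eq⟩

/-- **`κ(24) = 196560` in Lean**: `196560` is the greatest element of `kissingSizes 24` (attained by the Leech
lattice minimal vectors, built explicitly from the extended Golay code in `Configurations/Leech{Golay,Vectors,Count}`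
and `Leech.lean`; upper bound: the cell's kernel-checked sharp Delsarte LP certificate
`Kissing.kissing_dim24_le_196560`, Odlyzko–Sloane / Levenshtein 1979). [cite: ConwaySloane1999, Ch. 1 Table 1.2] -/
theorem kissing_dim24_eq : IsGreatest (kissingSizes 24) 196560 :=
  Leech.kissing_dim24_isGreatest

/-- The exact kissing numbers held in the tree as `IsGreatest` theorems, both sides proved: `κ(3) = 12`,
`κ(4) = 24`, `κ(8) = 240`, `κ(24) = 196560` — the four dimensions in which the kissing number is known.
[cite: ConwaySloane1999, Ch. 1 Table 1.2] -/
theorem kissing_exact_dims_3_4_8_24 :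
    IsGreatest (kissingSizes 3) 12 ∧ IsGreatest (kissingSizes 4) 24 ∧ IsGreatest (kissingSizes 8) 240 ∧
      IsGreatest (kissingSizes 24) 196560 :=
  ⟨kissing_dim3_eq, kissing_dim4_eq, kissing_dim8_eq, kissing_dim24_eq⟩

end Summit.Ventures.PackingBounds.Config
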